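import Summits.BirchSwinnertonDyer.BirchSwinnertonDyer.Theorems.ResidualThetaTransportAtTwoHeckeThetaPartnerAdicAtTwoUnitValues
import Summits.BirchSwinnertonDyer.BirchSwinnertonDyer.Theorems.ResidualThetaTransportAtTwoHeckeThetaPartnerAdicAtTwoTeichmullerTwistPrelim
import HarnessLib

/-!
# The type-`(1,0)` Größencharakter is a `p`-adic unit off `p𝔣` (generic prime; brick R3a of the odd-`p` theta partner)

Route `SignedLowerHalves`, child L `SmallImageLowerHalfBothSigns` (item stmt-BirchSwinnertonDyer-23599), line
proposal `rtt_w3`, stub K0₂@p `stub_heckeThetaPartner_ns` — brick R3a of the arithmetic half at an ODD prime (width seat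
`bsd-line-slh-p3-w3` gen 9; memo `Lines/birth_acns-MEMO-w3-g9.md`).  THEOREMS ONLY (no definition, no named fact, no
`sorry`); ROUTE-INDEPENDENT.

The tree's `HeckeThetaPartner.norm_symm_eq_one_of_principal_values` (`…AdicAtTwoUnitValues`, the unit hypothesis
`hU` of the Teichmüller twist `…TeichmullerTwist.exists_isGrossencharakter_congr` for the Größencharakter `ψ₀` of
`…TypeOneGrossencharakter.exists_isGrossencharakter_embType`) is written at the prime `2`.  This file is the same
statement and proof at an ARBITRARY prime `p` inert in `k` (`(p)` prime in `𝓞 k`):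

* `norm_symm_embedding_sub_one_lt_one'`, `norm_symm_embedding_eq_one_of_not_mem'` — `σ(x) ≡ 1` for `x ≡ 1 mod p`
  and `‖e⁻¹σ(y)‖ = 1` for `y ∉ p𝓞_k` (`(p)` prime), `e : ℚ̄_p ≃ ℂ`;
* `norm_symm_eq_one_of_principal_values'` — if `ψ̃₀((b)) = σ(b)·λ(b̄)` on principal ideals prime to `𝔣` then
  `‖e⁻¹ψ₀(v)‖ = 1` for every prime `v ≠ (p)`, `v ∤ 𝔣` (`v^h = (π)` principal, `π ∉ (p)`, `λ(π̄)` a root of unity).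

-- adapted from Summits/.../ResidualThetaTransportAtTwoHeckeThetaPartnerAdicAtTwo{MatchingAtTwoPrelim,UnitValues}.lean (2 ↦ p)

BSD, crux L and the stub are NOT proved here.  Reference: Neukirch, ANT VII §6 Def. (6.1), I §6.
-/

set_option autoImplicit false
set_option linter.dupNamespace false

noncomputable section

open scoped NumberField nonZeroDivisors
open NumberField IsDedekindDomain
open Literature.NumberTheory.LFunctions

namespace Summit.BirchSwinnertonDyer.BirchSwinnertonDyer.Theorems.SmallImageLambdaLowerThreeNsThetaPartner

open Summit.BirchSwinnertonDyer.BirchSwinnertonDyer.Theorems.HeckeThetaPartner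

variable {k : Type} [Field k] [NumberField k] {p : ℕ} [Fact p.Prime] (e : PadicAlgCl p ≃+* ℂ) (σ : k →+* ℂ)

/-- `‖e⁻¹σ(x) − 1‖ < 1` for `x ≡ 1 mod p𝓞_k`. [folklore] -/
theorem norm_symm_embedding_sub_one_lt_one' {x : 𝓞 k} (hx : x - 1 ∈ Ideal.span {(p : 𝓞 k)}) :
    ‖e.symm (σ (x : k)) - 1‖ < 1 := by
  obtain ⟨w, hw⟩ := Ideal.mem_span_singleton.mp hx
  have hx' : algebraMap (𝓞 k) k x = 1 + (p : k) * algebraMap (𝓞 k) k w := by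
    have := congrArg (algebraMap (𝓞 k) k) hw
    rw [map_sub, map_one, map_mul, map_natCast] at this
    linear_combination this
  change ‖e.symm (σ (algebraMap (𝓞 k) k x)) - 1‖ < 1
  have h : e.symm (σ (algebraMap (𝓞 k) k x)) - 1 = (p : PadicAlgCl p) * e.symm (σ (algebraMap (𝓞 k) k w)) := by
    rw [hx', map_add, map_mul, map_one, map_add, map_mul, map_one, map_natCast, map_natCast]
    ring
  rw [h, norm_mul]
  have hp : ‖(p : PadicAlgCl p)‖ < 1 := Literature.NumberTheory.Automorphic.PadicAlgCl.norm_natCast_p_lt_one p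
  exact (mul_le_of_le_one_right (norm_nonneg _) (norm_symm_embedding_le_one e σ w)).trans_lt hp

/-- `σ(y)` is a `p`-adic unit for `y ∉ p𝓞_k`, when `(p)` is prime: `y z ≡ 1 mod p` for some `z`. [folklore] -/
theorem norm_symm_embedding_eq_one_of_not_mem' (hp : (Ideal.span {(p : 𝓞 k)}).IsPrime) {y : 𝓞 k}
    (hy : y ∉ Ideal.span {(p : 𝓞 k)}) : ‖e.symm (σ (y : k))‖ = 1 := by
  set P := Ideal.span {(p : 𝓞 k)} with hPdef
  have hP0 : P ≠ ⊥ := by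
    rw [hPdef, Ne, Ideal.span_singleton_eq_bot]; exact_mod_cast (Fact.out : p.Prime).ne_zero
  haveI : P.IsMaximal := hp.isMaximal hP0
  letI : Field (𝓞 k ⧸ P) := Ideal.Quotient.field P
  have hunit : IsUnit (Ideal.Quotient.mk P y) :=
    Ne.isUnit (by rw [Ne, Ideal.Quotient.eq_zero_iff_mem]; exact hy)
  obtain ⟨z', hz'⟩ := hunit.exists_right_inv
  obtain ⟨z, rfl⟩ := Ideal.Quotient.mk_surjective z'
  rw [← map_mul, ← map_one (Ideal.Quotient.mk P), Ideal.Quotient.eq] at hz'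
  have hlt := norm_symm_embedding_sub_one_lt_one' e σ hz'
  have hyz : e.symm (σ ((y * z : 𝓞 k) : k)) = e.symm (σ (y : k)) * e.symm (σ (z : k)) := by
    push_cast; rw [map_mul, map_mul]
  rw [hyz] at hlt
  have h1 : ‖e.symm (σ (y : k)) * e.symm (σ (z : k))‖ = 1 := by
    have h' : ‖(1 : PadicAlgCl p) - e.symm (σ (y : k)) * e.symm (σ (z : k))‖ < ‖(1 : PadicAlgCl p)‖ := by
      rw [norm_sub_rev, norm_one]; exact hlt
    rw [ThetaLayerLambdaCongruenceAtTwo.norm_eq_of_norm_sub_lt_norm h', norm_one]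
  rw [norm_mul] at h1
  have hy1 := norm_symm_embedding_le_one e σ y
  have hz1 := norm_symm_embedding_le_one e σ z
  by_contra hne
  have hlt' : ‖e.symm (σ (y : k))‖ < 1 := lt_of_le_of_ne hy1 hne
  have : ‖e.symm (σ (y : k))‖ * ‖e.symm (σ (z : k))‖ < 1 :=
    (mul_le_of_le_one_right (norm_nonneg _) hz1).trans_lt hlt'
  exact absurd h1 this.ne

/-- Values of a character of the finite group `(𝓞_k/𝔣)ˣ` (`𝔣 ≠ 0`) are `p`-adic units along `e`. [folklore] -/
theorem norm_symm_unitCharacter_eq_one' {𝔣 : Ideal (𝓞 k)} (h𝔣 : 𝔣 ≠ ⊥)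
    (lam : (𝓞 k ⧸ 𝔣)ˣ →* ℂˣ) (u : (𝓞 k ⧸ 𝔣)ˣ) : ‖e.symm ((lam u : ℂˣ) : ℂ)‖ = 1 := by
  haveI : Finite (𝓞 k ⧸ 𝔣) := Ideal.finiteQuotientOfFreeOfNeBot 𝔣 h𝔣
  have hfin : IsOfFinOrder u := isOfFinOrder_of_finite u
  have hpow : ((lam u : ℂˣ) : ℂ) ^ orderOf u = 1 := by
    rw [← Units.val_pow_eq_pow_val, ← map_pow, pow_orderOf_eq_one, map_one, Units.val_one]
  exact norm_symm_eq_one_of_pow_eq_one e hfin.orderOf_pos hpow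

/-- **`ψ₀` is a `p`-adic unit off `p𝔣`** (`(p)` prime in `𝓞 k`): if `ψ̃₀((b)) = σ(b)·λ(b̄)` for every `b ≠ 0`
prime to `𝔣`, then `‖e⁻¹(ψ₀ v)‖ = 1` for every prime `v ≠ (p)` with `v ∤ 𝔣`.
[cite: NeukirchANT1999, Ch. VII §6 Def. (6.1)] -/
theorem norm_symm_eq_one_of_principal_values' (hp : (Ideal.span {(p : 𝓞 k)}).IsPrime)
    {𝔣 : Ideal (𝓞 k)} (h𝔣 : 𝔣 ≠ ⊥) (lam : (𝓞 k ⧸ 𝔣)ˣ →* ℂˣ) {ψ₀ : HeightOneSpectrum (𝓞 k) → ℂ}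
    (hval : ∀ (b : 𝓞 k), b ≠ 0 → ∀ hb : IsUnit (Ideal.Quotient.mk 𝔣 b),
      idealPow k ψ₀ (Ideal.span {b}) = σ (b : k) * (lam hb.unit : ℂ))
    (v : HeightOneSpectrum (𝓞 k)) (hvp : v.asIdeal ≠ Ideal.span {(p : 𝓞 k)})
    (hv𝔣 : ¬ 𝔣 ≤ v.asIdeal) : ‖e.symm (ψ₀ v)‖ = 1 := by
  classical
  set P := Ideal.span {(p : 𝓞 k)} with hPdef
  have hP0 : P ≠ ⊥ := by
    rw [hPdef, Ne, Ideal.span_singleton_eq_bot]; exact_mod_cast (Fact.out : p.Prime).ne_zero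
  haveI : P.IsMaximal := hp.isMaximal hP0
  obtain ⟨h, π, hh, hvh⟩ := exists_pow_eq_span_singleton v
  have hvh0 : v.asIdeal ^ h ≠ ⊥ := pow_ne_zero _ v.ne_bot
  have hπ0 : π ≠ 0 := by
    intro h0; apply hvh0; rw [hvh, h0, Ideal.span_singleton_eq_bot]
  have hπP : π ∉ P := by
    intro hπ
    have hle : v.asIdeal ^ h ≤ P := by
      rw [hvh, Ideal.span_singleton_le_iff_mem]; exact hπ
    have hvP : v.asIdeal ≤ P := (Ideal.IsPrime.pow_le_iff (I := v.asIdeal) hh.ne').mp hle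
    exact hvp (v.isMaximal.eq_of_le hp.ne_top hvP)
  have hπ𝔣 : IsCoprime (Ideal.span {π}) 𝔣 := by
    rw [← hvh]
    refine IsCoprime.pow_left ((isCoprime_iff_forall_not_le h𝔣).mpr fun w hw hvw => hv𝔣 ?_)
    have : v = w := HeightOneSpectrum.ext (v.isMaximal.eq_of_le w.isPrime.ne_top hvw)
    rwa [this]
  have hunit : IsUnit (Ideal.Quotient.mk 𝔣 π) := isUnit_mk_of_isCoprime hπ𝔣
  have hpow : ψ₀ v ^ h = σ (π : k) * (lam hunit.unit : ℂ) := by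
    rw [← idealPow_asIdeal ψ₀ v, ← idealPow_pow ψ₀ v.ne_bot, hvh]
    exact hval π hπ0 hunit
  have hnorm : ‖e.symm (ψ₀ v)‖ ^ h = 1 := by
    rw [← norm_pow, ← map_pow, hpow, map_mul, norm_mul, norm_symm_embedding_eq_one_of_not_mem' e σ hp hπP,
      norm_symm_unitCharacter_eq_one' e h𝔣 lam, one_mul]
  exact (pow_eq_one_iff_of_nonneg (norm_nonneg _) hh.ne').mp hnorm

end Summit.BirchSwinnertonDyer.BirchSwinnertonDyer.Theorems.SmallImageLambdaLowerThreeNsThetaPartner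

end
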